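import Summits.Ventures.YMGap.Thresholds.PressureZeroCoupling
import HarnessLib

/-!
# The `β = 0` endpoint in every dimension: the DLR state on `ℤ^d` is the infinite Haar product and the leading
# plaquette / free-energy coefficients are kernel derivatives (row type C-PRESS, part 5)

Cell `pub-ymgap`, seat ds-1 (gen 9). HONEST FRAMING: exact strong-coupling LATTICE statements at `b = 0` for `SU(N)` Wilson
lattice gauge theory on `ℤ^d`, every `d ≥ 2`, every `N ≥ 2`, hypothesis-free (Bakry–Émery modulus); one-sided derivatives at
the endpoint of the one-state window `[0, N/(12(d-1))]` (tree coupling); nothing about the continuum or the Clay problem.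
Kernel theorems only, 0 compute.

* `eq_zdHaar_of_mem_zero_dim` — THE DLR state at `b = 0` is `dg_∞` (uniqueness, part 3, + `zdHaar_mem_ymGibbsMeasures_zero`);
* ★ `cov_plaquette_zero_dim` — `Cov_ν(W_p, W_q) = δ_{pq} · charVariance/N²` for every `ν ∈ 𝒢(0)`;
* ★★ `hasDerivWithinAt_plaquette_zero_dim` — `u'(0⁺) = charVariance/N` (tree coupling) in EVERY dimension: the right
  derivative at `b = 0` of `b ↦ ⟨W_p⟩_{μ b}` along any DLR selection (g8's closed-window fluctuation–response formula
  `hasDerivWithinAt_integral_dim_thooft` at `0⁺` on the Haar product); `su2_hasDerivWithinAt_plaquette_zero_dim` (`SU(2)`: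
  `1/2`, i.e. `1/4` per unit of `β_W = 2b` — the Balian–Drouffe–Itzykson coefficient is dimension independent),
  `hasDerivWithinAt_plaquette_zero_dim_SU` (`N ≥ 3`: `1/(2N)`);
* ★ `hasDerivWithinAt_freeEnergyDensity_zero_dim` — `f'(0⁺) = -N · #planes = -N d(d-1)/2`.
-/

noncomputable section

open MeasureTheory ProbabilityTheory Set Filter Topology
open scoped NNReal
open Literature.MathematicalPhysics.QuantumLattice (LGConfig ZdEdge ZdPlaquette fundamentalRep ymGibbsMeasures
  ymSpecification plaquetteObs plaquetteEdges freeEnergyDensity IsZdTranslationInvariant continuous_fundamentalRep)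
open Literature.MathematicalPhysics.QuantumFieldTheory hiding ZdEdge

namespace Summit.Ventures.YMGap.PressureRegularity

/-! ## D. Every dimension `d ≥ 2`: the `β = 0` endpoint and the leading plaquette coefficient -/

section ZeroCouplingDim

open Literature.MathematicalPhysics.QuantumFieldTheory.PlaquetteLowerBound (charVariance)
open Literature.MathematicalPhysics.QuantumFieldTheory.TorusAreaLaw (isSpecialUnitaryModel_fundamentalRep)
open Summit.Ventures.YMGap.RobustBall.HaarSecondMoments (charVariance_su2 charVariance_suN)
open Summit.Ventures.YMGap.CouplingResponse (hasDerivWithinAt_integral_dim_thooft)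

variable {d N : ℕ}

/-- Local shorthand: the planes `{(i, j) : i < j}`. -/
local notation3 (prettyPrint := false) "𝔓" d => {q : Fin d × Fin d // q.1 < q.2}

/-- `SU(N)` is second countable (closed subgroup of `N × N` complex matrices). [folklore] -/
private theorem secondCountable_suN'' : SecondCountableTopology (Matrix.specialUnitaryGroup (Fin N) ℂ) :=
  haveI : SecondCountableTopology (Matrix (Fin N) (Fin N) ℂ) :=
    inferInstanceAs (SecondCountableTopology (Fin N → Fin N → ℂ))
  Topology.IsEmbedding.subtypeVal.secondCountableTopology

/-- **Every `SU(N)`, `N ≥ 2`, every `d ≥ 2`, `b = 0`: THE DLR state on `ℤ^d` is the infinite Haar product.** -/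
theorem eq_zdHaar_of_mem_zero_dim (hd : 2 ≤ d) (hN : 2 ≤ N)
    {ν : Measure (LGConfig d (Matrix.specialUnitaryGroup (Fin N) ℂ))}
    (hν : ν ∈ ymGibbsMeasures (d := d) (fundamentalRep (Fin N)) 0) :
    ν = zdHaar d (Matrix.specialUnitaryGroup (Fin N) ℂ) := by
  have hd' : (2 : ℝ) ≤ d := by exact_mod_cast hd
  exact eq_zdHaar_of_subsingleton _ (subsingleton_ymGibbsMeasures_dim_thooft hd hN
    ⟨le_rfl, div_nonneg (Nat.cast_nonneg N) (by nlinarith)⟩) hν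

/-- ★ **Plaquette covariances of THE `β = 0` state on `ℤ^d`, every `SU(N)`, `N ≥ 2`, every `d ≥ 2`**:
`Cov_ν(W_p, W_q) = δ_{pq} · charVariance/N²` for every `ν ∈ 𝒢(0)`. -/
theorem cov_plaquette_zero_dim (hd : 2 ≤ d) (hN : 2 ≤ N)
    {ν : Measure (LGConfig d (Matrix.specialUnitaryGroup (Fin N) ℂ))}
    (hν : ν ∈ ymGibbsMeasures (d := d) (fundamentalRep (Fin N)) 0) (p q : ZdPlaquette d) :
    cov[zdPlaquetteObs (fundamentalRep (Fin N)) p.1 p.2.1.1 p.2.1.2,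
        zdPlaquetteObs (fundamentalRep (Fin N)) q.1 q.2.1.1 q.2.1.2; ν] =
      if p = q then charVariance (fundamentalRep (Fin N)) / (N : ℝ) ^ 2 else 0 := by
  haveI := secondCountable_suN'' (N := N)
  rw [eq_zdHaar_of_mem_zero_dim hd hN hν]
  exact cov_zdPlaquetteObs_zdHaar (isSpecialUnitaryModel_fundamentalRep N) hN p q

/-- ★★ **Every `SU(N)`, `N ≥ 2`, EVERY dimension `d ≥ 2`: `u'(0⁺) = charVariance/N` in the tree coupling** — the right
derivative at `b = 0` (within `[0, N/(12(d-1))]`) of the mean plaquette `b ↦ ⟨W_p⟩_{μ b}` along any DLR selection; the value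
`N · Var_{Haar}(W_p)` does not depend on the dimension (one-plaquette term of the strong-coupling series). -/
theorem hasDerivWithinAt_plaquette_zero_dim (hd : 2 ≤ d) (hN : 2 ≤ N)
    {μ : ℝ → Measure (LGConfig d (Matrix.specialUnitaryGroup (Fin N) ℂ))}
    (hμ : ∀ b ∈ Icc (0 : ℝ) ((N : ℝ) / (12 * ((d : ℝ) - 1))), μ b ∈ ymGibbsMeasures (d := d) (fundamentalRep (Fin N)) b)
    (p : ZdPlaquette d) :
    HasDerivWithinAt (fun t => ∫ U, zdPlaquetteObs (fundamentalRep (Fin N)) p.1 p.2.1.1 p.2.1.2 U ∂(μ t))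
      (charVariance (fundamentalRep (Fin N)) / N : ℝ) (Icc (0 : ℝ) ((N : ℝ) / (12 * ((d : ℝ) - 1)))) 0 := by
  haveI := secondCountable_suN'' (N := N)
  have hN0 : (0 : ℝ) < N := by exact_mod_cast (show 0 < N by omega)
  have hd' : (2 : ℝ) ≤ d := by exact_mod_cast hd
  have htop : (0 : ℝ) ≤ (N : ℝ) / (12 * ((d : ℝ) - 1)) := div_nonneg hN0.le (by nlinarith)
  have h0 : μ 0 ∈ ymGibbsMeasures (d := d) (fundamentalRep (Fin N)) 0 := hμ 0 ⟨le_rfl, htop⟩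
  have h := hasDerivWithinAt_integral_dim_thooft hd hN hμ (isLipschitzCylinder_zdPlaquetteObs (N := N) p.1 p.2.2)
    (x₀ := p.1) (D := 1) (fun e he => by simpa using norm_fst_sub_le_of_mem_plaquetteEdges he)
    (b := 0) ⟨le_rfl, htop⟩
  rw [eq_zdHaar_of_mem_zero_dim hd hN h0,
    tsum_cov_zdPlaquetteObs_zdHaar (isSpecialUnitaryModel_fundamentalRep N) hN] at h
  refine h.congr_deriv ?_
  field_simp

/-- ★★ **`SU(2)` on `ℤ^d`, every `d ≥ 2`: `u'(0⁺) = 1/2` in the tree coupling, i.e. `1/4` per unit of Wilson's `β_W = 2β`**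
— the Balian–Drouffe–Itzykson leading coefficient is dimension independent. -/
theorem su2_hasDerivWithinAt_plaquette_zero_dim (hd : 2 ≤ d)
    {μ : ℝ → Measure (LGConfig d (Matrix.specialUnitaryGroup (Fin 2) ℂ))}
    (hμ : ∀ b ∈ Icc (0 : ℝ) ((2 : ℝ) / (12 * ((d : ℝ) - 1))), μ b ∈ ymGibbsMeasures (d := d) (fundamentalRep (Fin 2)) b)
    (p : ZdPlaquette d) :
    HasDerivWithinAt (fun t => ∫ U, zdPlaquetteObs (fundamentalRep (Fin 2)) p.1 p.2.1.1 p.2.1.2 U ∂(μ t))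
      (1 / 2 : ℝ) (Icc (0 : ℝ) ((2 : ℝ) / (12 * ((d : ℝ) - 1)))) 0 := by
  have h := hasDerivWithinAt_plaquette_zero_dim (N := 2) hd le_rfl (by exact_mod_cast hμ) p
  rw [charVariance_su2] at h
  exact_mod_cast h

/-- ★★ **`SU(N)`, `N ≥ 3`, on `ℤ^d`, every `d ≥ 2`: `u'(0⁺) = 1/(2N)` in the tree coupling.** -/
theorem hasDerivWithinAt_plaquette_zero_dim_SU (hd : 2 ≤ d) (hN : 3 ≤ N)
    {μ : ℝ → Measure (LGConfig d (Matrix.specialUnitaryGroup (Fin N) ℂ))}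
    (hμ : ∀ b ∈ Icc (0 : ℝ) ((N : ℝ) / (12 * ((d : ℝ) - 1))), μ b ∈ ymGibbsMeasures (d := d) (fundamentalRep (Fin N)) b)
    (p : ZdPlaquette d) :
    HasDerivWithinAt (fun t => ∫ U, zdPlaquetteObs (fundamentalRep (Fin N)) p.1 p.2.1.1 p.2.1.2 U ∂(μ t))
      (1 / (2 * N) : ℝ) (Icc (0 : ℝ) ((N : ℝ) / (12 * ((d : ℝ) - 1)))) 0 := by
  have hN0 : (0 : ℝ) < N := by exact_mod_cast (show 0 < N by omega)
  have h := hasDerivWithinAt_plaquette_zero_dim hd (by omega) hμ p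
  rw [charVariance_suN hN] at h
  refine h.congr_deriv ?_
  field_simp

/-- ★ **`f'(0⁺) = -N · d(d-1)/2` for every `SU(N)`, `N ≥ 2`, every `d ≥ 2`** (tree coupling): the right derivative of the
free energy density at `b = 0` within `[0, N/(12(d-1))]` — every plaquette has Haar mean zero. -/
theorem hasDerivWithinAt_freeEnergyDensity_zero_dim (hd : 2 ≤ d) (hN : 2 ≤ N) :
    HasDerivWithinAt (freeEnergyDensity d (fundamentalRep (Fin N)))
      (-((N : ℝ) * Fintype.card (𝔓 d))) (Icc (0 : ℝ) ((N : ℝ) / (12 * ((d : ℝ) - 1)))) 0 := by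
  classical
  haveI := secondCountable_suN'' (N := N)
  have hN0 : (0 : ℝ) < N := by exact_mod_cast (show 0 < N by omega)
  have hd' : (2 : ℝ) ≤ d := by exact_mod_cast hd
  have htop : (0 : ℝ) ≤ (N : ℝ) / (12 * ((d : ℝ) - 1)) := div_nonneg hN0.le (by nlinarith)
  obtain ⟨μ, hμ⟩ := CouplingResponse.exists_dlrSelection_dim (d := d) (N := N)
  have hsel : ∀ t ∈ Icc (0 : ℝ) ((N : ℝ) / (12 * ((d : ℝ) - 1))), μ t ∈ ymGibbsMeasures (d := d) (fundamentalRep (Fin N)) t :=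
    fun t _ => hμ t
  have h := hasDerivWithinAt_freeEnergyDensity_dim_thooft hd hN hsel (b := 0) ⟨le_rfl, htop⟩
  have hplaq : ∀ q : 𝔓 d, ∫ U, plaquetteObs (fundamentalRep (Fin N)) 0 q.1.1 q.1.2 U ∂(μ 0) = 0 := fun q => by
    rw [integral_plaquetteObs_eq_mul ((0 : Literature.Probability.LatticeModels.Site d), q) (μ 0),
      eq_zdHaar_of_mem_zero_dim hd hN (hμ 0),
      integral_zdPlaquetteObs_zdHaar (isSpecialUnitaryModel_fundamentalRep N) hN
        ((0 : Literature.Probability.LatticeModels.Site d), q), mul_zero]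
  simp only [hplaq, sub_zero, Finset.sum_const, Finset.card_univ, nsmul_eq_mul] at h
  refine h.congr_deriv ?_
  ring

end ZeroCouplingDim

end Summit.Ventures.YMGap.PressureRegularity

end
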